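import Summits.SmoothPoincare4.SmoothPoincare4.Theorems.WeakReductionDescentDependentTripleGenusThreeStandard
import Literature.Topology.FourManifolds.DependentTripleGenusThreeTrisectionsProofs
import Literature.Topology.FourManifolds.LoopSurgeryHomotopySphereGKProofs
import Literature.Barriers.SmoothPoincare4.LowGenusTrisectionsStandardOfClassification
import Literature.Topology.FourManifolds.GenusThreeSeparatingPairReducing
import Literature.Topology.FourManifolds.GenusThreePrimitiveOrReducing

/-!
# Crux `WeakReductionDescent.DependentTripleGenusThreeStandard` (stmt-SmoothPoincare4-18000) —
# line `Sketch`, REGISTERED skeleton v11 (lead c1, 2026-08-17): stubs 1, 2, 3, 4a = named Literature facts; apex = 4b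

The crux is, verbatim (`Iff.rfl`, `dependentTripleGenusThreeStandard_iff_arandaZupan`, p156575),
the homotopy-sphere corollary of Aranda–Zupan 2025 Thm. 1.4 (arXiv:2503.04607, p. 2; proof §7
pp. 24–26): a smooth `M ≃ₕ S⁴` with a genus-`3` GK-trisection admitting a dependent triple is
`≅ S⁴`.  It is SPC4-shielded (`BirthAttack.shield`), so it cannot be refuted short of an exotic
`S⁴`; this is a FORMALISATION crux and every stub below is a printed theorem.

## The line and its reshaping

The line handed to the lead is ideator 2's `Sketch` (`Cruxes/…/Ideator2Sketch.lean`, cards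
`cap-sphere-surgery` + `torsion-handle-addition`): X_F ⇐ (Thm 1.3 fact) + `SeparatingPairReducing`
(AZ25 Lemma 3.8 + parallel case) + [`PrimitiveOrReducing` (Lemma 3.7) + `AnnulusTrick` +
`PantsOfNonseparatingPairs` + `CapSphereLoopPartner`] + `msz_loopSurgery_homotopySphere_gk`, the
bracket composing (PROVED there) into the LOOP-PARTNER STEP of §7 case (3).

Reshaping by the lead (L1), keeping the composition idea and changing NO mathematics:

* the bracket is registered as ONE stub, `stub_loopPartnerNoRange` (v1: `stub_loopPartner`), in the binder shape the
  tree already tracks (`hP` of `DependentTripleGenusThreeTrisectionsProofs`, balanced form), with its CONCLUSION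
  WEAKENED for free in v2 (genus `≤ 2`, no MSZ-range clause: `mszRange_of_isCircleSurgery_of_genus_le_two`, PROVED).  Reason: the
  ideator's four finer statements are typed over a sketch-level `IsPrimitiveIn S p a :=
  ∃ d, IsCurve S d ∧ BoundsDisc S (H p) d ∧ ∃ x, a ∩ d = {x}` whose one-point intersection is
  SET-THEORETIC (the ideator says so: "transversality to be added downstream").  A tangential
  one-sided contact realises `a ∩ d = {x}` for ANY compressing curve `d` after a finger move, so
  that predicate is (nearly) idle: `PrimitiveOrReducing`/`AnnulusTrick`/`PantsCuffPrimitive`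
  become contentless and all the content — "H_j[a] is a handlebody" — is pushed into
  `CapSphereLoopPartner`, which then over-claims (it quantifies over every closed 4-manifold and
  is NOT shielded).  No transversality / geometric-intersection-number vocabulary for curves on
  the central surface exists in the tree (searched: `MeetsOnce`, `IsPrimitive`, `transvers`,
  `Heegaard` under Literature/Topology/FourManifolds), so registering those four stubs now would
  register mis-specified statements.  They stay the documented PROOF PLAN of `stub_loopPartner`
  (below) until a `Defs` item supplies transverse one-point intersection (or Gordon's
  "H[c] is a handlebody" form of primitivity).
* the two external theorems are registered in the forms the tree TRACKS them:
  `stub_weaklyReducibleStandard` = the barrier-catalogue fact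
  `az2025_weaklyReducible_genusThree_homotopySphere_gk.{0}` (AZ25 Thm 1.3 hs-corollary; it IS the
  sibling route item `GenusThreeBase`, stmt-SmoothPoincare4-17910, `genusThreeBase_iff_az2025`) —
  DELEGATED to that item; `stub_mszClassification` = `msz_trisection_classification_gk.{0}`
  (Meier–Schirmer–Zupan 2016 Thm 1.2) — DELEGATED to the fact's literature seats; it yields both
  `msz_homotopySphere_gk` (`msz_homotopySphere_gk_of_classification`, PROVED) and the loop-surgery
  fact (`msz_loopSurgery_homotopySphere_gk_of_classification`, PROVED).
* `stub_separatingPairWeaklyReducible` (v1/v2: `stub_separatingPairReducing` = the tree's `h38`, balanced form: AZ25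
  Lemma 3.8 with the parallel case folded in) — §7 configurations (1)–(2); v3 asks only for their printed USE,
  weak reducibility of `T`, given the whole indexed triple (free weakening: `isWeaklyReducible_of_boundsDisc_two`).

Composition `DependentTripleGenusThreeStandard_of` (sorry-free apart from the stubs): the tree's
PROVED glue `arandaZupan_dependentTriple_genusThree_homotopySphere_of_facts_of_notWeaklyReducible`
(reduction to `k = (1,1,1)` by MSZ and to not-weakly-reducible trisections by the Thm 1.3 fact), this
file's `notWeaklyReducibleCore_of_stubs` (§7 case split at set level + loop-surgery endgame with the range,
genus and smooth-loop clauses derived) and the route closing term `dependentTripleGenusThreeStandard_of_arandaZupan` (p156575).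

## Status of the stubs (v11; lead c1 cycle 1)

| stub | content | size | status |
|---|---|---|---|
| `stub_weaklyReducibleStandard` | AZ25 Thm 1.3 (hs) | XL | DELEGATED: sibling item stmt-17910 / fact seats (parked on Waldhausen) |
| `stub_mszClassification` | MSZ16 Thm 1.2 | XL | DELEGATED: literature fact seats (`LargeKTrisectionClassification.lean`) |
| (v8 3a `stub_boundsDisc_of_annularChart`) | configuration (1): discs transport across an annular chart of `F` | L | **CLOSED** p168238 (+ p167603, p167751); no longer a stub (the v9 glue does not need the case split) |
| `stub_separatingPairReducing` (3, v9) | AZ25 Lemma 3.8 on a genus-3 spine with `k_l ≤ 1` (+ parallel remark) | XL | DELEGATED: named fact `arandaZupan_separatingPair_reducing_gk` (p172489, review); v8's 3b ⇐ it PROVED (`sepPairWeaklyReducible_of_separatingPairReducing`) |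
| (v9 4 `stub_loopPartnerNoRange`) | §7 case (3) ⇒ loop partner of genus `≤ 2` | XL ×3 | v10: PROVED from 4a + 4b (`loopPartnerNoRange_of_stubs`) |
| `stub_primitiveOrReducing` (4a, v10) | AZ25 Lemma 3.7 on a genus-3 spine with `k_l ≤ 1` (transverse-one-point duals) | XL | DELEGATED: named fact `arandaZupan_nonSeparatingPair_primitiveOrReducing_gk` + predicate `Trisection.MeetsOnceTransv` (p172829, review; inlined until landed) |
| `stub_loopPartnerOfDuals` (4b, v10) | pants triple + ¬WR + duals for every pair ⇒ loop partner of genus `≤ 2` (slides, five-chain, Lemma 5.4, Prop 5.5) | XL ×3 | OPEN, the APEX (lead); diagrammatic, crux-sized |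

Infrastructure landed under `--supports` this cycle (all `Summit.SmoothPoincare4.SmoothPoincare4.Theorems.*`):
reductions p166686 / p167784 / p168204 (crux BY NAME ⇐ the registered stubs; endgame, configuration
split and relabelling glue); 3a with Aux p167603 (intrinsic closed-disc embedding criterion), p167751
(sweep diffeomorphism of a handlebody); p169761 + p169348 (push-offs with annular charts); p169105 (round
circles are curves); p168969 + p169356 (sectors orientable, `∂W ≅ S²×S¹` at `k i = 1` — the 3-manifold of
stub 3b's Lemma 3.8); p168316 (framed tubes of 2-spheres in homotopy 4-spheres); p169749 + p168844 +
p169353 (a `(2,2)` sphere surgery is undone by a circle surgery — AZ Prop 5.5 converse); p170019 (every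
smoothly embedded S² of a homotopy 4-sphere gives `IsCircleSurgery X′ M ℓ` with `X′` its surgery — the
generic 4-D half of stub 4); exactness `IsWeaklyReducible ⇒ HasDependentTriple` (Aux p170108, p170146;
main in flight) and the corner local-structure lemma (in flight).

Disproof side: no `Disproof.lean` published for this crux during the cycle; `BirthAttack.lean`
(refuter): crux SURVIVES, hypotheses satisfiable on paper, `e` load-bearing.
-/

noncomputable section

set_option linter.dupNamespace false

open scoped Manifold ContDiff Topology ContinuousMap
open Set
open Literature.Topology.FourManifolds
open Literature.Topology.FourManifolds.Trisection
open Summit.SmoothPoincare4.SmoothPoincare4.Theses.WeakReductionDescent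

namespace Summit.SmoothPoincare4.SmoothPoincare4.Cruxes.DependentTripleGenusThreeStandard.Sketch

/-! ## The registered stubs -/

/-- **Stub 1 (DELEGATED — sibling item `GenusThreeBase`, stmt-SmoothPoincare4-17910): Aranda–Zupan
2025 Thm. 1.3, homotopy-sphere corollary, in the barrier-catalogue form the tree tracks.**  A smooth
homotopy 4-sphere with a WEAKLY REDUCIBLE genus-`3` GK-trisection is `≅ S⁴`.  Equivalent to the route
item `GenusThreeBase` (`Theorems.genusThreeBase_iff_az2025`).  Printed proof: Prop. 3.9, §§4–6 of
arXiv:2503.04607 on [MSZ16], [MZ17b], Waldhausen; tracked in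
`Literature/Barriers/SmoothPoincare4/WeaklyReducibleGenusThreeStandard*.lean` down to the inline
five-chain-surgery step `h5` + `msz_trisection_classification_gk` +
`isConnectedSum_of_reducing_separating`. [cite: ArandaZupan2025, Thm. 1.3 (p. 2)] -/
theorem stub_weaklyReducibleStandard :
    Literature.Barriers.SmoothPoincare4.az2025_weaklyReducible_genusThree_homotopySphere_gk.{0} := by
  sorry

/-- **Stub 2 (DELEGATED — literature fact seats): Meier–Schirmer–Zupan 2016 Thm. 1.2**, the
classification of closed connected oriented 4-manifolds with a `(g; k₀, k₁, k₂)`-trisection in the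
range `∃ i, g ≤ kᵢ + 1` as `#^{k′}(S¹ × S³)` or `#^{k′}(S¹ × S³) # (±ℂP²)`, in the form the tree tracks
(`LargeKTrisectionClassification.lean`).  It supplies BOTH external inputs of the endgame:
`msz_homotopySphere_gk` (`msz_homotopySphere_gk_of_classification`, PROVED) and
`msz_loopSurgery_homotopySphere_gk` (`msz_loopSurgery_homotopySphere_gk_of_classification`, PROVED).
[cite: MeierSchirmerZupan2016, Thm. 1.2] -/
theorem stub_mszClassification : msz_trisection_classification_gk.{0} := by
  sorry

/-- **Stub 3 (v9 — RESHAPED by lead c1: the named fact behind configuration (2); DELEGATED to the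
literature, review-queued as p172489 `Literature.Topology.FourManifolds.arandaZupan_separatingPair_reducing_gk`,
LANDED as a named fact (ACCEPTED p172489); this stub is its universe-`0` instance): Aranda–Zupan 2025, Lemma 3.8, on the
spine of a genus-three GK-trisection.**  Printed (p. 10): "Suppose `H₁ ∪_Σ H₂` is a genus-three
Heegaard splitting of `Y = S³` or `S¹ × S²`, and let `c₁` and `c₂` be a weak-reducing pair of
non-separating but mutually separating curves.  Then either `c₁` is a reducing curve or `c₂` is a
reducing curve."  Here, for an orientable smooth `M` with a `(3; k)`-trisection `T` and labels
`i, j, l` with `k l ≤ 1` (so `H_i ∪_F H_j = ∂X_l ≅ #^{k_l}(S¹ × S²) ∈ {S³, S¹ × S²}`): disjoint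
non-separating curves `x ⊂ H_i`-compressing, `y ⊂ H_j`-compressing with `F ∖ (x ∪ y)`
disconnected ⟹ `x` compresses in `H_j` too or `y` in `H_i` too.  With concrete curves the
parallel pair (configuration (1), §7 p. 24) is admitted as well; there the conclusion is the
printed remark "In case (1), `𝒯` is weakly reducible" (p. 25) — and is moreover PROVED in the tree
in annular-chart form (stub 3a, `Theorems.stub_boundsDisc_of_annularChart`, p168238).  This is
binder for binder the inline hypothesis `hL38` of
`DependentTripleGenusThreeTrisectionsProofs.fiveChainCase_of_separatingPair_of_pantsCase` at general
`k` plus orientability.  v8's stub 3b (`stub_separatingPairWeaklyReducible_of_noAnnularChart01`,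
its USE for the pair `f 0 ⊂ H_0`, `f 1 ⊂ H_1` of a dependent triple of a `(3;1,1,1)`-trisected
homotopy sphere) follows from it by the PROVED glue `sepPairWeaklyReducible_of_separatingPairReducing`
below (third curve + `isWeaklyReducible_of_boundsDisc_two`; no relabelling needed, the fact is
label-symmetric).  Printed proof: untelescoping / thin position (Prop. 2.4 [CG87, ST94]),
Lemmas 3.4, 3.6, Remark 2.1 — none of it in the tree (XL, `3`-manifold topology).
[cite: ArandaZupan2025, Lemma 3.8 (p. 10); §2 (pp. 3–5), Remark 2.3; §7 (pp. 24–25)] -/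
theorem stub_separatingPairReducing : arandaZupan_separatingPair_reducing_gk.{0} := by
  sorry

/-- **Stub 4a (v10 — the named fact behind the pants case; DELEGATED to the literature,
LANDED as `Literature.Topology.FourManifolds.arandaZupan_nonSeparatingPair_primitiveOrReducing_gk`
together with the predicate `Trisection.MeetsOnceTransv` (ACCEPTED p172829); this stub is its universe-`0`
instance): Aranda–Zupan 2025, Lemma 3.7, on the spine of a genus-three GK-trisection.**
Printed (p. 9): "Suppose `H₁ ∪_Σ H₂` is a genus-three Heegaard splitting of `Y = S³` or `S¹ × S²`,
and let `c₁` and `c₂` be a weak-reducing pair of mutually non-separating curves. Then one of the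
following holds: (1) There exists a compressing curve `c′₂` for `H₂` such that `|c′₂ ∩ c₁| = 1` and
`c′₂ ∩ c₂ = ∅`, (2) There exists a compressing curve `c′₁` for `H₁` such that `|c′₁ ∩ c₂| = 1` and
`c′₁ ∩ c₁ = ∅`, (3) `c₁` is a reducing curve, or (4) `c₂` is a reducing curve."  Here on the
splitting `H_i ∪_F H_j = ∂X_l` (`k l ≤ 1`) of an orientable `(3; k)`-trisected `M`, with `c₁ = x`,
`c₂ = y`, and "`|c ∩ c′| = 1`" rendered for concrete curves as ONE TRANSVERSE intersection point
(`c ∩ c′ = {x₀}` and the tangent lines of smooth parametrisations at `x₀` meet only in `0` — the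
inlined `Trisection.MeetsOnceTransv`; a bare set-theoretic `{x₀}` would admit tangential touching
and make "primitive" nearly idle, cf. the v1 reshaping note in the module docstring).  This is the
`3`-dimensional input of §7 case (3) (p. 25: "Applying Lemma 3.7 to the Heegaard splitting
`H_α ∪ H_β` … Next, we apply Lemma 3.7 to the Heegaard splitting `H_α ∪ H_γ`").  Printed proof:
thin position (Prop. 2.4 [CG87, ST94]), Lemmas 3.4, 3.5, Remark 2.1, no incompressible tori in
`S³`, `S¹ × S²` — none in the tree (XL). [cite: ArandaZupan2025, Lemma 3.7 (p. 9); §2 (pp. 3–5); §7 (p. 25)] -/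
theorem stub_primitiveOrReducing : arandaZupan_nonSeparatingPair_primitiveOrReducing_gk.{0} := by
  sorry

/-- **Stub 4b (v10 — the APEX proper, held by the lead: the DIAGRAMMATIC core of §7 case (3),
i.e. v9's stub 4 downstream of Lemma 3.7).**  A `(3; 1,1,1)`-trisected `M ≃ₕ S⁴` with a pants-type
triple `f` (`f i ⊂ H_i` compressing, pairwise disjoint, non-separating, every pair mutually
non-separating, the union separating `F`) that is NOT weakly reducible, and for EVERY ordered pair
`i ≠ j` a DUAL as Lemma 3.7 (1)/(2) supplies it — a compressing curve of `H_j` meeting `f i` once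
transversally and missing `f j`, or one of `H_i` meeting `f j` once transversally and missing
`f i` — is a circle surgery on a loop of some smooth `X′` GK-trisected in genus `≤ 2`.
Printed proof (pp. 25–26, from "we can suppose without loss of generality that there is some `β₂`"
on): a dual through the pants `P` is a single seam plus waves, the waves removable by handle
slides over the cuff of the same colour, whence the dual meets BOTH other cuffs once (this is also
why the duality pattern always contains a fork — the "symmetric up to permutation" sentence);
slides of `γ₂` over `γ₁` along arcs of `β₂` give the five-chain `{γ₁, β₂, α₁, γ₂*, β₁}` (Fig. 19);
Lemma 5.4 (five-chain surgery yields a `(2; k₁, k₂, k₃ + 1)`-trisection DIAGRAM, realised by some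
`X′`) and Prop. 5.5 (`X` is surgery on a loop in `X′`, via Thm 5.1 = [AM22] ⋆-trisections, slides
and a destabilisation, and "a diagram determines the trisected 4-manifold").  Every step past the
first needs trisection-DIAGRAM vocabulary (cut systems, handle slides, realisation and uniqueness
of the 4-manifold of a diagram, ⋆-trisections) that the tree does not have: crux-sized, see
PROMOTE/HANDOFF.  The conclusion keeps v2's free weakening (genus `≤ 2`, no MSZ range, no
smoothness clause: `helper_loopPartner_of_noRange`).
[cite: ArandaZupan2025, §7 (pp. 25–26), Lemma 5.4 and Prop. 5.5 (pp. 19–20), Thm. 5.1 (p. 17)] -/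
theorem stub_loopPartnerOfDuals :
    ∀ (M : Type) [TopologicalSpace M] [T2Space M] [SecondCountableTopology M]
      [ChartedSpace (EuclideanSpace ℝ (Fin 4)) M] [IsManifold (𝓡 4) ∞ M],
      M ≃ₕ (Metric.sphere (0 : EuclideanSpace ℝ (Fin 5)) 1) → ∀ T : Fin 3 → Set M, IsGKTrisection M 3 (fun _ => 1) T →
      ∀ f : Fin 3 → Set M,
      ((∀ i, IsCurve T (f i)) ∧ (Pairwise fun i j => Disjoint (f i) (f j)) ∧
        (∀ i, IsNonSeparating T (f i)) ∧ (∀ i, BoundsDisc T (spineHandlebody T i) (f i)) ∧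
        (∀ i j, i ≠ j → IsConnected (centralSurfaceSet T \ (f i ∪ f j))) ∧
        ¬ IsPreconnected (centralSurfaceSet T \ ⋃ i, f i)) →
      ¬ IsWeaklyReducible T →
      (∀ i j : Fin 3, i ≠ j →
        (∃ y' : Set M, IsCurve T y' ∧ BoundsDisc T (spineHandlebody T j) y' ∧
          MeetsOnceTransv y' (f i) ∧ Disjoint y' (f j)) ∨
        (∃ x' : Set M, IsCurve T x' ∧ BoundsDisc T (spineHandlebody T i) x' ∧
          MeetsOnceTransv x' (f j) ∧ Disjoint x' (f i))) →
      ∃ (X' : Type) (_ : TopologicalSpace X') (_ : T2Space X') (_ : SecondCountableTopology X')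
        (_ : ChartedSpace (EuclideanSpace ℝ (Fin 4)) X') (_ : IsManifold (𝓡 4) ∞ X')
        (g' : ℕ) (k' : Fin 3 → ℕ) (T' : Fin 3 → Set X')
        (ℓ : Metric.sphere (0 : EuclideanSpace ℝ (Fin 2)) 1 → X'),
        g' ≤ 2 ∧ IsGKTrisection X' g' k' T' ∧ IsCircleSurgery (𝓡 4) (𝓡 4) X' M ℓ := by
  sorry

/-- **v9's stub 4 (the loop-partner step of §7 case (3)) from stubs 4a and 4b** (PROVED glue: the
first paragraph of the printed case (3), p. 25).  For each ordered pair `i ≠ j` apply the Lemma 3.7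
statement to the splitting `H_i ∪_F H_j = ∂X_l` (`k_l = 1`; `M ≃ₕ S⁴` is orientable,
`isOrientable_of_homotopyEquiv_sphere_four_holds`): alternatives (3)/(4) put `f i` in `H_j` or `f j`
in `H_i`, and then the third curve `f l ⊂ H_l` completes a weak reduction
(`isWeaklyReducible_of_boundsDisc_two`) — "If any of the curves bounds a disk in another
handlebody, then the splitting is weakly reducible" — contradicting `¬ IsWeaklyReducible T`; so
(1)/(2) hold for every pair, which is the duals hypothesis of stub 4b.
[cite: ArandaZupan2025, §7 (p. 25)] -/
theorem loopPartnerNoRange_of_primitiveOrReducing_of_duals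
    (h37 : arandaZupan_nonSeparatingPair_primitiveOrReducing_gk.{0})
    (h4b : ∀ (M : Type) [TopologicalSpace M] [T2Space M] [SecondCountableTopology M]
      [ChartedSpace (EuclideanSpace ℝ (Fin 4)) M] [IsManifold (𝓡 4) ∞ M],
      M ≃ₕ (Metric.sphere (0 : EuclideanSpace ℝ (Fin 5)) 1) → ∀ T : Fin 3 → Set M, IsGKTrisection M 3 (fun _ => 1) T →
      ∀ f : Fin 3 → Set M,
      ((∀ i, IsCurve T (f i)) ∧ (Pairwise fun i j => Disjoint (f i) (f j)) ∧
        (∀ i, IsNonSeparating T (f i)) ∧ (∀ i, BoundsDisc T (spineHandlebody T i) (f i)) ∧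
        (∀ i j, i ≠ j → IsConnected (centralSurfaceSet T \ (f i ∪ f j))) ∧
        ¬ IsPreconnected (centralSurfaceSet T \ ⋃ i, f i)) →
      ¬ IsWeaklyReducible T →
      (∀ i j : Fin 3, i ≠ j →
        (∃ y' : Set M, IsCurve T y' ∧ BoundsDisc T (spineHandlebody T j) y' ∧
          MeetsOnceTransv y' (f i) ∧ Disjoint y' (f j)) ∨
        (∃ x' : Set M, IsCurve T x' ∧ BoundsDisc T (spineHandlebody T i) x' ∧
          MeetsOnceTransv x' (f j) ∧ Disjoint x' (f i))) →
      ∃ (X' : Type) (_ : TopologicalSpace X') (_ : T2Space X') (_ : SecondCountableTopology X')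
        (_ : ChartedSpace (EuclideanSpace ℝ (Fin 4)) X') (_ : IsManifold (𝓡 4) ∞ X')
        (g' : ℕ) (k' : Fin 3 → ℕ) (T' : Fin 3 → Set X')
        (ℓ : Metric.sphere (0 : EuclideanSpace ℝ (Fin 2)) 1 → X'),
        g' ≤ 2 ∧ IsGKTrisection X' g' k' T' ∧ IsCircleSurgery (𝓡 4) (𝓡 4) X' M ℓ) :
    ∀ (M : Type) [TopologicalSpace M] [T2Space M] [SecondCountableTopology M]
      [ChartedSpace (EuclideanSpace ℝ (Fin 4)) M] [IsManifold (𝓡 4) ∞ M],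
      M ≃ₕ (Metric.sphere (0 : EuclideanSpace ℝ (Fin 5)) 1) → ∀ T : Fin 3 → Set M, IsGKTrisection M 3 (fun _ => 1) T →
      ∀ f : Fin 3 → Set M,
      ((∀ i, IsCurve T (f i)) ∧ (Pairwise fun i j => Disjoint (f i) (f j)) ∧
        (∀ i, IsNonSeparating T (f i)) ∧ (∀ i, BoundsDisc T (spineHandlebody T i) (f i)) ∧
        (∀ i j, i ≠ j → IsConnected (centralSurfaceSet T \ (f i ∪ f j))) ∧
        ¬ IsPreconnected (centralSurfaceSet T \ ⋃ i, f i)) →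
      ¬ IsWeaklyReducible T →
      ∃ (X' : Type) (_ : TopologicalSpace X') (_ : T2Space X') (_ : SecondCountableTopology X')
        (_ : ChartedSpace (EuclideanSpace ℝ (Fin 4)) X') (_ : IsManifold (𝓡 4) ∞ X')
        (g' : ℕ) (k' : Fin 3 → ℕ) (T' : Fin 3 → Set X')
        (ℓ : Metric.sphere (0 : EuclideanSpace ℝ (Fin 2)) 1 → X'),
        g' ≤ 2 ∧ IsGKTrisection X' g' k' T' ∧ IsCircleSurgery (𝓡 4) (𝓡 4) X' M ℓ := by
  intro M _ _ _ _ _ e T hT f hf hwr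
  obtain ⟨hcur, hdis, hns, hbd, hconn, hdep⟩ := hf
  have hM : IsOrientable (𝓡 4) M := isOrientable_of_homotopyEquiv_sphere_four_holds M e
  have third : ∀ i j : Fin 3, i ≠ j → ∃ l : Fin 3, l ≠ i ∧ l ≠ j := by decide
  refine h4b M e T hT f ⟨hcur, hdis, hns, hbd, hconn, hdep⟩ hwr fun i j hij => ?_
  obtain ⟨l, hli, hlj⟩ := third i j hij
  rcases h37 M hM (fun _ => 1) T hT i j l hij hli hlj le_rfl (f i) (f j) (hcur i) (hcur j)
      (hdis hij) (hns i) (hns j) (hconn i j hij) (hbd i) (hbd j) with h | h | h | h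
  · exact Or.inl h
  · exact Or.inr h
  · -- (3): `f i` compresses in `H_i` and `H_j`; `f l ⊂ H_l` completes a weak reduction
    exact absurd (isWeaklyReducible_of_boundsDisc_two (p := l) (i := i) (j := j) hij hli.symm
      hlj.symm (hcur l) (hcur i) (hdis hli) (hns l) (hns i) (hbd l) (hbd i) h) hwr
  · -- (4): `f j` compresses in `H_j` and `H_i`
    exact absurd (isWeaklyReducible_of_boundsDisc_two (p := l) (i := j) (j := i) hij.symm hlj.symm
      hli.symm (hcur l) (hcur j) (hdis hlj) (hns l) (hns j) (hbd l) (hbd j) h) hwr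

/-- **v9's stub 4 (`stub_loopPartnerNoRange`) as a theorem of v10** (PROVED glue): the previous
theorem fed with the registered stubs 4a and 4b. [cite: ArandaZupan2025, §7 (pp. 25–26)] -/
theorem loopPartnerNoRange_of_stubs :
    ∀ (M : Type) [TopologicalSpace M] [T2Space M] [SecondCountableTopology M]
      [ChartedSpace (EuclideanSpace ℝ (Fin 4)) M] [IsManifold (𝓡 4) ∞ M],
      M ≃ₕ (Metric.sphere (0 : EuclideanSpace ℝ (Fin 5)) 1) → ∀ T : Fin 3 → Set M, IsGKTrisection M 3 (fun _ => 1) T →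
      ∀ f : Fin 3 → Set M,
      ((∀ i, IsCurve T (f i)) ∧ (Pairwise fun i j => Disjoint (f i) (f j)) ∧
        (∀ i, IsNonSeparating T (f i)) ∧ (∀ i, BoundsDisc T (spineHandlebody T i) (f i)) ∧
        (∀ i j, i ≠ j → IsConnected (centralSurfaceSet T \ (f i ∪ f j))) ∧
        ¬ IsPreconnected (centralSurfaceSet T \ ⋃ i, f i)) →
      ¬ IsWeaklyReducible T →
      ∃ (X' : Type) (_ : TopologicalSpace X') (_ : T2Space X') (_ : SecondCountableTopology X')
        (_ : ChartedSpace (EuclideanSpace ℝ (Fin 4)) X') (_ : IsManifold (𝓡 4) ∞ X')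
        (g' : ℕ) (k' : Fin 3 → ℕ) (T' : Fin 3 → Set X')
        (ℓ : Metric.sphere (0 : EuclideanSpace ℝ (Fin 2)) 1 → X'),
        g' ≤ 2 ∧ IsGKTrisection X' g' k' T' ∧ IsCircleSurgery (𝓡 4) (𝓡 4) X' M ℓ :=
  loopPartnerNoRange_of_primitiveOrReducing_of_duals stub_primitiveOrReducing stub_loopPartnerOfDuals

/-! ## The composition (sorry-free apart from the stubs), concluding the crux BY NAME -/

/-- **A separating pair of a dependent triple makes a `(3; 1,1,1)`-trisected homotopy 4-sphere
weakly reducible — from the Lemma 3.8 fact (PROVED glue; LANDED in the tree as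
`Theorems.helper_sepPairWeaklyReducible_of_separatingPairReducing`, p172692, over the inlined
statement; restated here over the fact's name to keep the workfile's import cone small).**  The
pair complement contains the (non-empty) triple complement, so it is not preconnected;
`M ≃ₕ S⁴` is orientable (`isOrientable_of_homotopyEquiv_sphere_four_holds`); Lemma 3.8 applied to
the splitting `H_i ∪_F H_j = ∂X_l` (`k_l = 1`) puts `f i` in `H_j` or `f j` in `H_i`, and the
third curve `f l ⊂ H_l` completes a weak reduction (`isWeaklyReducible_of_boundsDisc_two`).
[cite: ArandaZupan2025, §7 (pp. 24–25)] -/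
theorem sepPairWeaklyReducible_of_separatingPairReducing
    (h38 : arandaZupan_separatingPair_reducing_gk.{0}) :
    ∀ (M : Type) [TopologicalSpace M] [T2Space M] [SecondCountableTopology M]
      [ChartedSpace (EuclideanSpace ℝ (Fin 4)) M] [IsManifold (𝓡 4) ∞ M],
      M ≃ₕ (Metric.sphere (0 : EuclideanSpace ℝ (Fin 5)) 1) → ∀ T : Fin 3 → Set M,
      IsGKTrisection M 3 (fun _ => 1) T →
      ∀ f : Fin 3 → Set M,
      (∀ i, IsCurve T (f i)) → (Pairwise fun i j => Disjoint (f i) (f j)) →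
      (∀ i, IsNonSeparating T (f i)) → (∀ i, BoundsDisc T (spineHandlebody T i) (f i)) →
      ¬ IsPreconnected (centralSurfaceSet T \ ⋃ i, f i) →
      ∀ i j : Fin 3, i ≠ j → ¬ IsConnected (centralSurfaceSet T \ (f i ∪ f j)) →
      IsWeaklyReducible T := by
  intro M _ _ _ _ _ e T hT f hcur hdis hns hbd hdep i j hij hsep
  -- the third label
  have third : ∀ i j : Fin 3, i ≠ j → ∃ l : Fin 3, l ≠ i ∧ l ≠ j := by decide
  obtain ⟨l, hli, hlj⟩ := third i j hij
  -- the pair complement is non-empty (it contains the triple complement), hence not preconnected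
  have hne : (centralSurfaceSet T \ (f i ∪ f j)).Nonempty := by
    have hne3 : (centralSurfaceSet T \ ⋃ m, f m).Nonempty :=
      Set.nonempty_iff_ne_empty.2 fun h => hdep (h ▸ isPreconnected_empty)
    exact hne3.mono (Set.sdiff_subset_sdiff_right
      (union_subset (subset_iUnion f i) (subset_iUnion f j)))
  have hpre : ¬ IsPreconnected (centralSurfaceSet T \ (f i ∪ f j)) := fun h => hsep ⟨hne, h⟩
  have hM : IsOrientable (𝓡 4) M := isOrientable_of_homotopyEquiv_sphere_four_holds M e
  rcases h38 M hM (fun _ => 1) T hT i j l hij hli hlj le_rfl (f i) (f j) (hcur i) (hcur j)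
      (hdis hij) (hns i) (hns j) hpre (hbd i) (hbd j) with h | h
  · -- `f i` compresses in `H_i` and in `H_j`; `f l ⊂ H_l` completes the weak reduction
    exact isWeaklyReducible_of_boundsDisc_two (p := l) (i := i) (j := j) hij hli.symm hlj.symm
      (hcur l) (hcur i) (hdis hli) (hns l) (hns i) (hbd l) (hbd i) h
  · exact isWeaklyReducible_of_boundsDisc_two (p := l) (i := j) (j := i) hij.symm hlj.symm hli.symm
      (hcur l) (hcur j) (hdis hlj) (hns l) (hns j) (hbd l) (hbd j) h

/-- **v3's stub 3 (a separating pair of a dependent triple makes the trisection weakly reducible)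
from the registered stub 3** (PROVED glue: the previous theorem fed with
`stub_separatingPairReducing`). [cite: ArandaZupan2025, §7 (pp. 24–25)] -/
theorem separatingPairWeaklyReducible_of_stubs :
    ∀ (M : Type) [TopologicalSpace M] [T2Space M] [SecondCountableTopology M]
      [ChartedSpace (EuclideanSpace ℝ (Fin 4)) M] [IsManifold (𝓡 4) ∞ M],
      M ≃ₕ (Metric.sphere (0 : EuclideanSpace ℝ (Fin 5)) 1) → ∀ T : Fin 3 → Set M, IsGKTrisection M 3 (fun _ => 1) T →
      ∀ f : Fin 3 → Set M,
      (∀ i, IsCurve T (f i)) → (Pairwise fun i j => Disjoint (f i) (f j)) →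
      (∀ i, IsNonSeparating T (f i)) → (∀ i, BoundsDisc T (spineHandlebody T i) (f i)) →
      ¬ IsPreconnected (centralSurfaceSet T \ ⋃ i, f i) →
      ∀ i j : Fin 3, i ≠ j → ¬ IsConnected (centralSurfaceSet T \ (f i ∪ f j)) →
      IsWeaklyReducible T :=
  sepPairWeaklyReducible_of_separatingPairReducing stub_separatingPairReducing

/-- **The Meier–Schirmer–Zupan range of a low-genus loop partner of a homotopy 4-sphere is
automatic (PROVED; the free half of AZ25 Lemma 5.4's type statement).**  If `M ≃ₕ S⁴` is a circle
surgery on a loop of `X′` and `X′` carries a `(g′; k′)`-GK-trisection with `g′ ≤ 2`, then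
`∃ i, g′ ≤ k′ i + 1`: `ℓ` is a smooth embedding (core of the surgery's tubular neighbourhood,
`CircleNbhd.isSmoothEmbedding_core`), `X′` is compact and connected (it is trisected), orientable
(`isOrientable_of_isCircleSurgery_four_holds`, as `M` is), so `k′₀ + k′₁ + k′₂ = g′ + 2`
(`gkTrisection_sum_eq_add_two_of_loopSurgery_homotopySphere_holds`: `χ(X′) = χ(M) − 2 = 0`), and
for `g′ ≤ 1` the clause is trivial while for `g′ = 2` a sum of `4` over three indices has a term
`≥ 2`. [cite: GayKirby2016, Remark 2] [cite: MeierSchirmerZupan2016, Remark 3.12] -/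
theorem mszRange_of_isCircleSurgery_of_genus_le_two
    {X' : Type} [TopologicalSpace X'] [T2Space X'] [SecondCountableTopology X']
    [ChartedSpace (EuclideanSpace ℝ (Fin 4)) X'] [IsManifold (𝓡 4) ∞ X']
    {g' : ℕ} {k' : Fin 3 → ℕ} {T' : Fin 3 → Set X'} (hg' : g' ≤ 2) (hT' : IsGKTrisection X' g' k' T')
    {ℓ : Metric.sphere (0 : EuclideanSpace ℝ (Fin 2)) 1 → X'}
    {M : Type} [TopologicalSpace M] [T2Space M] [SecondCountableTopology M]
    [ChartedSpace (EuclideanSpace ℝ (Fin 4)) M] [IsManifold (𝓡 4) ∞ M] (e : M ≃ₕ (Metric.sphere (0 : EuclideanSpace ℝ (Fin 5)) 1))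
    (hs : IsCircleSurgery (𝓡 4) (𝓡 4) X' M ℓ) : ∃ i, g' ≤ k' i + 1 := by
  have hℓ : Manifold.IsSmoothEmbedding (𝓡 1) (𝓡 4) ∞ ℓ := by
    obtain ⟨ν, -⟩ := hs
    exact ν.isSmoothEmbedding_core
  haveI : CompactSpace X' := hT'.compactSpace
  haveI : ConnectedSpace X' := hT'.connectedSpace
  have hM : IsOrientable (𝓡 4) M := isOrientable_of_homotopyEquiv_sphere_four_holds M e
  have hX' : IsOrientable (𝓡 4) X' := isOrientable_of_isCircleSurgery_four_holds X' ℓ M hs hM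
  have hsum : k' 0 + k' 1 + k' 2 = g' + 2 :=
    gkTrisection_sum_eq_add_two_of_loopSurgery_homotopySphere_holds X' hX' g' k' T' hT' ℓ hℓ M e hs
  by_contra h
  push Not at h
  have h0 := h 0
  have h1 := h 1
  have h2 := h 2
  omega

/-- **The loop-surgery endgame for a genus-`≤ 2` loop partner (PROVED glue).**  The tree's glue
(`pantsTriple_of_loopSurgery_of_loopPartner_type`) wants genus exactly `2`, the MSZ-range clause and
a smooth `ℓ` only to feed `msz_loopSurgery_homotopySphere_gk`, which accepts ANY `(g′; k′)` in the
MSZ range; all three are derived here (`mszRange_of_isCircleSurgery_of_genus_le_two`,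
`CircleNbhd.isSmoothEmbedding_core`), so a genus-`≤ 2` trisected loop partner of a homotopy
4-sphere already forces `M ≅ S⁴`. [cite: MeierSchirmerZupan2016, Thm. 1.2] [cite: ArandaZupan2025, §2 p. 7] -/
theorem helper_loopPartner_of_noRange
    {M : Type} [TopologicalSpace M] [T2Space M] [SecondCountableTopology M]
    [ChartedSpace (EuclideanSpace ℝ (Fin 4)) M] [IsManifold (𝓡 4) ∞ M] (e : M ≃ₕ (Metric.sphere (0 : EuclideanSpace ℝ (Fin 5)) 1))
    {X' : Type} [TopologicalSpace X'] [T2Space X'] [SecondCountableTopology X']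
    [ChartedSpace (EuclideanSpace ℝ (Fin 4)) X'] [IsManifold (𝓡 4) ∞ X']
    {g' : ℕ} {k' : Fin 3 → ℕ} {T' : Fin 3 → Set X'} (hg' : g' ≤ 2) (hT' : IsGKTrisection X' g' k' T')
    {ℓ : Metric.sphere (0 : EuclideanSpace ℝ (Fin 2)) 1 → X'}
    (hs : IsCircleSurgery (𝓡 4) (𝓡 4) X' M ℓ)
    (hL : msz_loopSurgery_homotopySphere_gk) : Nonempty (M ≃ₘ⟮𝓡 4, 𝓡 4⟯ (Metric.sphere (0 : EuclideanSpace ℝ (Fin 5)) 1)) := by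
  have hℓ : Manifold.IsSmoothEmbedding (𝓡 1) (𝓡 4) ∞ ℓ := by
    obtain ⟨ν, -⟩ := hs
    exact ν.isSmoothEmbedding_core
  exact Literature.Barriers.SmoothPoincare4.nonempty_diffeomorph_sphere_of_isCircleSurgery_of_mszRange
    hL hT' (mszRange_of_isCircleSurgery_of_genus_le_two hg' hT' e hs) hℓ hs e

/-- **The pants-triple statement `hp` at type `(1,1,1)` from the loop-surgery fact and the
reshaped stub** (PROVED glue; replaces `pantsTriple_of_loopSurgery_of_loopPartner_type` of the
tree, whose `hP` wants genus `2` and the range clause). [cite: ArandaZupan2025, §7 (pp. 25–26)] -/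
theorem pantsTriple_of_loopSurgery_of_loopPartnerNoRange (hL : msz_loopSurgery_homotopySphere_gk)
    (hP : ∀ (M : Type) [TopologicalSpace M] [T2Space M] [SecondCountableTopology M]
      [ChartedSpace (EuclideanSpace ℝ (Fin 4)) M] [IsManifold (𝓡 4) ∞ M],
      M ≃ₕ (Metric.sphere (0 : EuclideanSpace ℝ (Fin 5)) 1) → ∀ T : Fin 3 → Set M, IsGKTrisection M 3 (fun _ => 1) T →
      ∀ f : Fin 3 → Set M,
      ((∀ i, IsCurve T (f i)) ∧ (Pairwise fun i j => Disjoint (f i) (f j)) ∧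
        (∀ i, IsNonSeparating T (f i)) ∧ (∀ i, BoundsDisc T (spineHandlebody T i) (f i)) ∧
        (∀ i j, i ≠ j → IsConnected (centralSurfaceSet T \ (f i ∪ f j))) ∧
        ¬ IsPreconnected (centralSurfaceSet T \ ⋃ i, f i)) →
      ¬ IsWeaklyReducible T →
      ∃ (X' : Type) (_ : TopologicalSpace X') (_ : T2Space X') (_ : SecondCountableTopology X')
        (_ : ChartedSpace (EuclideanSpace ℝ (Fin 4)) X') (_ : IsManifold (𝓡 4) ∞ X')
        (g' : ℕ) (k' : Fin 3 → ℕ) (T' : Fin 3 → Set X')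
        (ℓ : Metric.sphere (0 : EuclideanSpace ℝ (Fin 2)) 1 → X'),
        g' ≤ 2 ∧ IsGKTrisection X' g' k' T' ∧ IsCircleSurgery (𝓡 4) (𝓡 4) X' M ℓ) :
    ∀ (M : Type) [TopologicalSpace M] [T2Space M] [SecondCountableTopology M]
      [ChartedSpace (EuclideanSpace ℝ (Fin 4)) M] [IsManifold (𝓡 4) ∞ M],
      M ≃ₕ (Metric.sphere (0 : EuclideanSpace ℝ (Fin 5)) 1) → ∀ T : Fin 3 → Set M, IsGKTrisection M 3 (fun _ => 1) T →
      ∀ f : Fin 3 → Set M,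
      ((∀ i, IsCurve T (f i)) ∧ (Pairwise fun i j => Disjoint (f i) (f j)) ∧
        (∀ i, IsNonSeparating T (f i)) ∧ (∀ i, BoundsDisc T (spineHandlebody T i) (f i)) ∧
        (∀ i j, i ≠ j → IsConnected (centralSurfaceSet T \ (f i ∪ f j))) ∧
        ¬ IsPreconnected (centralSurfaceSet T \ ⋃ i, f i)) →
      ¬ IsWeaklyReducible T → Nonempty (M ≃ₘ⟮𝓡 4, 𝓡 4⟯ (Metric.sphere (0 : EuclideanSpace ℝ (Fin 5)) 1)) := by
  intro M _ _ _ _ _ e T hT f hf hwr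
  obtain ⟨X', _, _, _, _, _, g', k', T', ℓ, hg', hT', hs⟩ := hP M e T hT f hf hwr
  exact helper_loopPartner_of_noRange e hg' hT' hs hL

/-- **The not-weakly-reducible core at type `(1,1,1)` from the two line stubs and the
loop-surgery fact** (PROVED glue; the §7 case split at SET level, as in the tree's
`notWeaklyReducibleCore_of_separatingPair_of_pantsTriple_type`, but consuming only weak
reducibility from the separating-pair stub): write the dependent triple in indexed form
(`hasDependentTriple_iff_exists_fun`); if some pair `f i ∪ f j` separates `F`, stub 3 contradicts
`¬ IsWeaklyReducible T`; otherwise `f` is of pants type and stub 4 + the endgame apply.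
[cite: ArandaZupan2025, §7 (pp. 24–26)] -/
theorem notWeaklyReducibleCore_of_stubs (hL : msz_loopSurgery_homotopySphere_gk)
    (h12 : ∀ (M : Type) [TopologicalSpace M] [T2Space M] [SecondCountableTopology M]
      [ChartedSpace (EuclideanSpace ℝ (Fin 4)) M] [IsManifold (𝓡 4) ∞ M],
      M ≃ₕ (Metric.sphere (0 : EuclideanSpace ℝ (Fin 5)) 1) → ∀ T : Fin 3 → Set M, IsGKTrisection M 3 (fun _ => 1) T →
      ∀ f : Fin 3 → Set M,
      (∀ i, IsCurve T (f i)) → (Pairwise fun i j => Disjoint (f i) (f j)) →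
      (∀ i, IsNonSeparating T (f i)) → (∀ i, BoundsDisc T (spineHandlebody T i) (f i)) →
      ¬ IsPreconnected (centralSurfaceSet T \ ⋃ i, f i) →
      ∀ i j : Fin 3, i ≠ j → ¬ IsConnected (centralSurfaceSet T \ (f i ∪ f j)) →
      IsWeaklyReducible T)
    (h3 : ∀ (M : Type) [TopologicalSpace M] [T2Space M] [SecondCountableTopology M]
      [ChartedSpace (EuclideanSpace ℝ (Fin 4)) M] [IsManifold (𝓡 4) ∞ M],
      M ≃ₕ (Metric.sphere (0 : EuclideanSpace ℝ (Fin 5)) 1) → ∀ T : Fin 3 → Set M, IsGKTrisection M 3 (fun _ => 1) T →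
      ∀ f : Fin 3 → Set M,
      ((∀ i, IsCurve T (f i)) ∧ (Pairwise fun i j => Disjoint (f i) (f j)) ∧
        (∀ i, IsNonSeparating T (f i)) ∧ (∀ i, BoundsDisc T (spineHandlebody T i) (f i)) ∧
        (∀ i j, i ≠ j → IsConnected (centralSurfaceSet T \ (f i ∪ f j))) ∧
        ¬ IsPreconnected (centralSurfaceSet T \ ⋃ i, f i)) →
      ¬ IsWeaklyReducible T →
      ∃ (X' : Type) (_ : TopologicalSpace X') (_ : T2Space X') (_ : SecondCountableTopology X')
        (_ : ChartedSpace (EuclideanSpace ℝ (Fin 4)) X') (_ : IsManifold (𝓡 4) ∞ X')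
        (g' : ℕ) (k' : Fin 3 → ℕ) (T' : Fin 3 → Set X')
        (ℓ : Metric.sphere (0 : EuclideanSpace ℝ (Fin 2)) 1 → X'),
        g' ≤ 2 ∧ IsGKTrisection X' g' k' T' ∧ IsCircleSurgery (𝓡 4) (𝓡 4) X' M ℓ) :
    ∀ (M : Type) [TopologicalSpace M] [T2Space M] [SecondCountableTopology M]
      [ChartedSpace (EuclideanSpace ℝ (Fin 4)) M] [IsManifold (𝓡 4) ∞ M],
      M ≃ₕ (Metric.sphere (0 : EuclideanSpace ℝ (Fin 5)) 1) → ∀ T : Fin 3 → Set M, IsGKTrisection M 3 (fun _ => 1) T →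
        HasDependentTriple T → ¬ IsWeaklyReducible T → Nonempty (M ≃ₘ⟮𝓡 4, 𝓡 4⟯ (Metric.sphere (0 : EuclideanSpace ℝ (Fin 5)) 1)) := by
  intro M _ _ _ _ _ e T hT hdt hwr
  rw [hasDependentTriple_iff_exists_fun] at hdt
  obtain ⟨f, hcur, hdis, hns, hbd, hdep⟩ := hdt
  by_cases hconn : ∀ i j : Fin 3, i ≠ j → IsConnected (centralSurfaceSet T \ (f i ∪ f j))
  · -- configuration (3): a pants-type triple
    exact pantsTriple_of_loopSurgery_of_loopPartnerNoRange hL h3 M e T hT f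
      ⟨hcur, hdis, hns, hbd, hconn, hdep⟩ hwr
  · -- configurations (1)–(2): some pair separates
    push Not at hconn
    obtain ⟨i, j, hij, hsep⟩ := hconn
    exact absurd (h12 M e T hT f hcur hdis hns hbd hdep i j hij hsep) hwr

/-- **The Literature fact from the four stubs** (pure logic over PROVED tree glue): the MSZ
classification gives `msz_homotopySphere_gk` and the loop-surgery fact; the reduction to
`k = (1,1,1)` and to not-weakly-reducible trisections is `…_of_facts_of_notWeaklyReducible`; the
core is `notWeaklyReducibleCore_of_stubs`. [cite: ArandaZupan2025, Thm. 1.4 (p. 2) and §7 (pp. 24–26)] -/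
theorem arandaZupan_dependentTriple_of_stubs : arandaZupan_dependentTriple_genusThree_homotopySphere :=
  arandaZupan_dependentTriple_genusThree_homotopySphere_of_facts_of_notWeaklyReducible
    (Literature.Barriers.SmoothPoincare4.az2025_weaklyReducible_genusThree_homotopySphere_gk_iff_routeShape_univ.mp
      stub_weaklyReducibleStandard)
    (Literature.Barriers.SmoothPoincare4.msz_homotopySphere_gk_of_univ
      (Literature.Barriers.SmoothPoincare4.msz_homotopySphere_gk_of_classification
        stub_mszClassification))
    (notWeaklyReducibleCore_of_stubs
      (msz_loopSurgery_homotopySphere_gk_of_classification stub_mszClassification)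
      separatingPairWeaklyReducible_of_stubs loopPartnerNoRange_of_stubs)

/-- **THE SKELETON THEOREM: the crux `DependentTripleGenusThreeStandard` BY NAME from the four
registered stubs** (route closing term `dependentTripleGenusThreeStandard_of_arandaZupan`, p156575).
[cite: ArandaZupan2025, Thm. 1.4 and Cor. 1.5 (p. 2)] -/
theorem DependentTripleGenusThreeStandard_of : DependentTripleGenusThreeStandard :=
  Summit.SmoothPoincare4.SmoothPoincare4.Theorems.dependentTripleGenusThreeStandard_of_arandaZupan
    arandaZupan_dependentTriple_of_stubs

end Summit.SmoothPoincare4.SmoothPoincare4.Cruxes.DependentTripleGenusThreeStandard.Sketch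

end
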